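import Mathlib

/-!
# `OffTetraSectorKernel`, line `odd-hyperbolic-ladder`: covariance of lifted simplices (stub `stub_spxCovariance`)

Stub `stub_spxCovariance` of the crux `OffTetraSectorKernel` (stmt-KontsevichZagierPeriods-10557, route
HyperbolicBloch), skeleton v3. Points `p = (p₀, p₁, p₂)` of the upper half space `{0 < p₂}` lift to the
paraboloid vector `Ql p = (|p|², p₀, p₁, 1) ∈ ℝ⁴`; four rows `v : Fin 4 → Fin 4 → ℝ` span the open
geodesic simplex `Spx v = {p | 0 < p₂ ∧ ∀ a, 0 < det v · det (v with row a := Ql p)}` (all four Cramer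
coordinates of `Ql p` have the sign of `det v`). A map `g` of the half space onto itself acting on lifts
LINEARLY up to a positive scalar, `Ql (g p) = c p • M (Ql p)` with `c p > 0` and `det M ≠ 0`, maps `Spx v`
onto the simplex whose rows are `M · (rows of v)`.

Proof (pure linear algebra). With `V = Matrix.of v`, the matrix of mapped rows is `V * Mᵀ`
(`spxCovariance_of_mulVec_rows`), of determinant `det V * det M`; replacing its row `a` by
`Ql (g p) = M (c p • Ql p) = (c p • Ql p) ᵥ* Mᵀ` gives `(V.updateRow a (c p • Ql p)) * Mᵀ`
(`Matrix.updateRow_mul`), of determinant `c p * det (V.updateRow a (Ql p)) * det M`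
(`Matrix.det_updateRow_smul`). Hence every defining product is multiplied by the positive factor
`c p * (det M)²` (`spxCovariance_det_prod`), so for `p` in the half space `g p ∈ Spx (M v) ↔ p ∈ Spx v`;
the surjectivity of `g` on the half space gives the reverse inclusion.

References: J. L. Dupont, C.-H. Sah, *Scissors congruences II*, J. Pure Appl. Algebra 25 (1982), §3
(isometries of hyperbolic space act linearly on the lifts); the statement itself is folklore linear algebra.
-/

open Set

namespace Summit.KontsevichZagierPeriods.HyperbolicBloch.OffTetraSectorKernel

/-- Mapping every row of `v` by `M` is right multiplication of `Matrix.of v` by `Mᵀ`. [folklore] -/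
theorem spxCovariance_of_mulVec_rows {n : Type*} [Fintype n] (M : Matrix n n ℝ) (v : n → n → ℝ) :
    (Matrix.of fun i => M.mulVec (v i)) = Matrix.of v * M.transpose := by
  ext i j
  simp [Matrix.mul_apply, Matrix.mulVec, dotProduct, mul_comm]

/-- Replacing row `a` of the matrix of mapped rows by `s • M r` multiplies the defining product
`det (rows) * det (rows with row a replaced)` of the original rows by the factor `s * (det M)²`.
[folklore] -/
theorem spxCovariance_det_prod {n : Type*} [Fintype n] [DecidableEq n] (M : Matrix n n ℝ)
    (v : n → n → ℝ) (a : n) (s : ℝ) (r : n → ℝ) :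
    (Matrix.of fun i => M.mulVec (v i)).det *
        ((Matrix.of fun i => M.mulVec (v i)).updateRow a (s • M.mulVec r)).det =
      (s * M.det ^ 2) * ((Matrix.of v).det * ((Matrix.of v).updateRow a r).det) := by
  rw [spxCovariance_of_mulVec_rows, ← Matrix.mulVec_smul, ← Matrix.vecMul_transpose,
    ← Matrix.updateRow_mul, Matrix.det_mul, Matrix.det_mul, Matrix.det_transpose,
    Matrix.det_updateRow_smul]
  ring

/-- STUB `stub_spxCovariance` (isometries act on lifted simplices through their Lorentz matrices; pure
linear algebra). If `g` maps the open upper half space onto itself and acts on lifts by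
`Ql (g p) = c p • M (Ql p)` with `c p > 0` and `det M ≠ 0`, then `g '' Spx v = Spx (M v)` (rows mapped by
`M`): both determinants in the defining products pick up the factor `det M`, and the updated one the
positive factor `c p`. Instances used by the line: boundary similarities (`c = 1`), the unit inversion
composed with `w ↦ -w` (`c p = 1/|p|²`, `M (n, x, y, m) = (m, -x, -y, n)`). [folklore] -/
theorem stub_spxCovariance :
    ∀ (Ql : (Fin 3 → ℝ) → Fin 4 → ℝ), (∀ p, Ql p = ![p 0 ^ 2 + p 1 ^ 2 + p 2 ^ 2, p 0, p 1, 1]) →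
    ∀ (Spx : (Fin 4 → Fin 4 → ℝ) → Set (Fin 3 → ℝ)),
      (∀ v, Spx v = {p | 0 < p 2 ∧ ∀ a, 0 < (Matrix.of v).det * ((Matrix.of v).updateRow a (Ql p)).det}) →
    ∀ (g : (Fin 3 → ℝ) → (Fin 3 → ℝ)) (M : Matrix (Fin 4) (Fin 4) ℝ) (c : (Fin 3 → ℝ) → ℝ), M.det ≠ 0 →
      (∀ p : Fin 3 → ℝ, 0 < p 2 → 0 < c p ∧ 0 < g p 2 ∧ Ql (g p) = c p • M.mulVec (Ql p)) →
      (∀ p' : Fin 3 → ℝ, 0 < p' 2 → ∃ p : Fin 3 → ℝ, 0 < p 2 ∧ g p = p') →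
      ∀ v : Fin 4 → Fin 4 → ℝ, g '' Spx v = Spx (fun i => M.mulVec (v i)) := by
  intro Ql _hQl Spx hSpx g M c hM hg hsurj v
  -- for `p` in the half space, every defining product of `g p` with respect to the mapped rows is the
  -- multiple by `c p * (det M)²` of the corresponding defining product of `p` with respect to `v`
  have key : ∀ p : Fin 3 → ℝ, 0 < p 2 → ∀ a : Fin 4,
      (Matrix.of fun i => M.mulVec (v i)).det *
          ((Matrix.of fun i => M.mulVec (v i)).updateRow a (Ql (g p))).det =
        (c p * M.det ^ 2) * ((Matrix.of v).det * ((Matrix.of v).updateRow a (Ql p)).det) := by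
    intro p hp a
    rw [(hg p hp).2.2]
    exact spxCovariance_det_prod M v a (c p) (Ql p)
  -- and that factor is positive
  have hfac : ∀ p : Fin 3 → ℝ, 0 < p 2 → 0 < c p * M.det ^ 2 := by
    intro p hp
    have hc : 0 < c p := (hg p hp).1
    positivity
  ext p'
  simp only [Set.mem_image, hSpx, Set.mem_setOf_eq]
  constructor
  · rintro ⟨p, ⟨hp2, hp⟩, rfl⟩
    refine ⟨(hg p hp2).2.1, fun a => ?_⟩
    rw [key p hp2 a]
    exact mul_pos (hfac p hp2) (hp a)
  · rintro ⟨hp'2, hp'⟩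
    obtain ⟨p, hp2, rfl⟩ := hsurj p' hp'2
    refine ⟨p, ⟨hp2, fun a => ?_⟩, rfl⟩
    have h := hp' a
    rw [key p hp2 a] at h
    exact (mul_pos_iff_of_pos_left (hfac p hp2)).mp h

end Summit.KontsevichZagierPeriods.HyperbolicBloch.OffTetraSectorKernel
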